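import Summits.Ventures.PercRepro.C026ProdCSLemmaA

/-!
# THEOREM PROD ((CS) composition): generators, the cone `K`, the family functionals (p5, gen 16)

mine-3's product theorem for (CS) (`proofs/MINE3-PRODUCT.md` §0–§1, LEANSHEET §C), the abstract
setting. A NORMALIZED GENERATOR is `g = (ζ, ρ, σ, ν, α, β)` with `ζ + ρ + σ + ν = 1` (the
distribution of the `a`-bit / `b`-bit of a component among its `N²`-allowed configurations and its
two cell fractions), `u = ρ + ν`, `v = σ + ν`. The cone `K` (`MemK`): nonnegativity, `ρ ≤ α`,
`σ ≤ β` (C1), `ν² ≤ αβ` (C3), `u² ≤ α`, `v² ≤ β` (C4). For a finite family `g : ι → Gen` over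
`s`: `N = 1 − Π (1 − vᵢ) − Π (1 − uᵢ) + Π ζᵢ`, `𝒜 = Π (1 + αᵢ) − 1`, `ℬ = Π (1 + βᵢ) − 1`, and
THEOREM PROD is `N² ≤ 𝒜ℬ` (the (CS) inequality `N ≤ √(𝒜ℬ)`).

This file: the definitions; the independent generators `e a b` and the family `E1`
(`IsE1`: `a + b ≥ 1`); `N_nonneg`; **the `E1` base case** `sq_le_of_forall_isE1` (Lemma A);
**the convexity** `sq_le_of_convex` (the cone `N² ≤ 𝒜ℬ` is convex); **the factorisation at one
index** (`N_eq_rest`, `calA_eq_rest`, `calB_eq_rest`) and **the monotonicity** `N_rest_mono`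
(`N` is monotone in `(u, v, ν)` of one generator, the others fixed).
-/

namespace PercRepro

namespace ProdCS

open Finset

/-- A normalized generator `(ζ, ρ, σ, ν, α, β)`. -/
structure Gen where
  /-- no bit -/
  ζ : ℝ
  /-- `a`-bit only -/
  ρ : ℝ
  /-- `b`-bit only -/
  σ : ℝ
  /-- both bits -/
  ν : ℝ
  /-- the cell `ac|b` fraction -/
  α : ℝ
  /-- the cell `bc|a` fraction -/
  β : ℝ

namespace Gen

/-- `u = ρ + ν`, the probability of an `a`-bit. -/
def u (g : Gen) : ℝ := g.ρ + g.ν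

/-- `v = σ + ν`, the probability of a `b`-bit. -/
def v (g : Gen) : ℝ := g.σ + g.ν

/-- **The cone `K`** (normalized): nonnegativity, `ζ + ρ + σ + ν = 1`, (C1) `ρ ≤ α`, `σ ≤ β`,
(C3) `ν² ≤ αβ`, (C4) `u² ≤ α`, `v² ≤ β`. -/
structure MemK (g : Gen) : Prop where
  /-- `0 ≤ ζ` -/
  ζ_nonneg : 0 ≤ g.ζ
  /-- `0 ≤ ρ` -/
  ρ_nonneg : 0 ≤ g.ρ
  /-- `0 ≤ σ` -/
  σ_nonneg : 0 ≤ g.σ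
  /-- `0 ≤ ν` -/
  ν_nonneg : 0 ≤ g.ν
  /-- `0 ≤ α` -/
  α_nonneg : 0 ≤ g.α
  /-- `0 ≤ β` -/
  β_nonneg : 0 ≤ g.β
  /-- normalization -/
  norm : g.ζ + g.ρ + g.σ + g.ν = 1
  /-- (C1) -/
  ρ_le : g.ρ ≤ g.α
  /-- (C1) -/
  σ_le : g.σ ≤ g.β
  /-- (C3) -/
  c3 : g.ν ^ 2 ≤ g.α * g.β
  /-- (C4) -/
  c4a : (g.ρ + g.ν) ^ 2 ≤ g.α
  /-- (C4) -/
  c4b : (g.σ + g.ν) ^ 2 ≤ g.β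

/-- **The independent generator** `e(a, b)`: independent bits with `P(a-bit) = a`,
`P(b-bit) = b`, cells `a²`, `b²`. -/
def e (a b : ℝ) : Gen := ⟨(1 - a) * (1 - b), a * (1 - b), b * (1 - a), a * b, a ^ 2, b ^ 2⟩

/-- **The family `E1`**: the independent generators with `a + b ≥ 1`. -/
def IsE1 (g : Gen) : Prop :=
  ∃ a b : ℝ, 0 ≤ a ∧ a ≤ 1 ∧ 0 ≤ b ∧ b ≤ 1 ∧ 1 ≤ a + b ∧ g = e a b

/-- `e(a, b) ∈ K` when `a, b ∈ [0, 1]` and `a + b ≥ 1`. -/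
theorem memK_e {a b : ℝ} (ha0 : 0 ≤ a) (ha1 : a ≤ 1) (hb0 : 0 ≤ b) (hb1 : b ≤ 1)
    (hab : 1 ≤ a + b) : MemK (e a b) := by
  refine ⟨mul_nonneg (by linarith) (by linarith), mul_nonneg ha0 (by linarith),
    mul_nonneg hb0 (by linarith), mul_nonneg ha0 hb0, sq_nonneg a, sq_nonneg b, by simp [e]; ring,
    ?_, ?_, ?_, ?_, ?_⟩
  · simp only [e]; nlinarith
  · simp only [e]; nlinarith
  · simp only [e]; nlinarith [sq_nonneg (a * b)]
  · simp only [e]; nlinarith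
  · simp only [e]; nlinarith

/-- A member of `E1` is in `K`. -/
theorem MemK.of_isE1 {g : Gen} (h : IsE1 g) : MemK g := by
  obtain ⟨a, b, ha0, ha1, hb0, hb1, hab, rfl⟩ := h
  exact memK_e ha0 ha1 hb0 hb1 hab

end Gen

open Gen

/-! ### The family functionals -/

variable {ι : Type*}

/-- `N = 1 − Π (1 − vᵢ) − Π (1 − uᵢ) + Π ζᵢ`: the `N²`-fraction of the product. -/
noncomputable def N (s : Finset ι) (g : ι → Gen) : ℝ :=
  1 - ∏ i ∈ s, (1 - (g i).v) - ∏ i ∈ s, (1 - (g i).u) + ∏ i ∈ s, (g i).ζ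

/-- `𝒜 = Π (1 + αᵢ) − 1`: the cell `ac|b` of the product. -/
noncomputable def calA (s : Finset ι) (g : ι → Gen) : ℝ := ∏ i ∈ s, (1 + (g i).α) - 1

/-- `ℬ = Π (1 + βᵢ) − 1`: the cell `bc|a` of the product. -/
noncomputable def calB (s : Finset ι) (g : ι → Gen) : ℝ := ∏ i ∈ s, (1 + (g i).β) - 1

/-- (CS) for a family: `N² ≤ 𝒜ℬ`. -/
def CS (s : Finset ι) (g : ι → Gen) : Prop := N s g ^ 2 ≤ calA s g * calB s g

section Facts

variable {s : Finset ι} {g : ι → Gen}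

/-- `Π (1 − uᵢ) ≤ 1` etc.: the bit probabilities lie in `[0, 1]`. -/
theorem u_mem {i : ι} (h : MemK (g i)) : 0 ≤ (g i).u ∧ (g i).u ≤ 1 := by
  unfold Gen.u
  have := h.norm; have := h.ρ_nonneg; have := h.ν_nonneg; have := h.ζ_nonneg; have := h.σ_nonneg
  constructor <;> linarith

/-- `v ∈ [0, 1]`. -/
theorem v_mem {i : ι} (h : MemK (g i)) : 0 ≤ (g i).v ∧ (g i).v ≤ 1 := by
  unfold Gen.v
  have := h.norm; have := h.ρ_nonneg; have := h.ν_nonneg; have := h.ζ_nonneg; have := h.σ_nonneg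
  constructor <;> linarith

/-- `ζ ≤ 1 − u` and `ζ ≤ 1 − v`. -/
theorem ζ_le {i : ι} (h : MemK (g i)) : (g i).ζ ≤ 1 - (g i).u ∧ (g i).ζ ≤ 1 - (g i).v := by
  unfold Gen.u Gen.v
  have := h.norm; have := h.ρ_nonneg; have := h.σ_nonneg
  constructor <;> linarith

/-- `0 ≤ 𝒜`. -/
theorem calA_nonneg (hK : ∀ i ∈ s, MemK (g i)) : 0 ≤ calA s g := by
  unfold calA
  have : (1 : ℝ) ≤ ∏ i ∈ s, (1 + (g i).α) :=
    Finset.one_le_prod fun i hi => by linarith [(hK i hi).α_nonneg]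
  linarith

/-- `0 ≤ ℬ`. -/
theorem calB_nonneg (hK : ∀ i ∈ s, MemK (g i)) : 0 ≤ calB s g := by
  unfold calB
  have : (1 : ℝ) ≤ ∏ i ∈ s, (1 + (g i).β) :=
    Finset.one_le_prod fun i hi => by linarith [(hK i hi).β_nonneg]
  linarith

/-- `Π ζᵢ ≤ Π (1 − uᵢ)`. -/
theorem prod_ζ_le_prod_u (hK : ∀ i ∈ s, MemK (g i)) :
    ∏ i ∈ s, (g i).ζ ≤ ∏ i ∈ s, (1 - (g i).u) :=
  Finset.prod_le_prod (fun i hi => (hK i hi).ζ_nonneg) fun i hi => (ζ_le (hK i hi)).1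

/-- `Π ζᵢ ≤ Π (1 − vᵢ)`. -/
theorem prod_ζ_le_prod_v (hK : ∀ i ∈ s, MemK (g i)) :
    ∏ i ∈ s, (g i).ζ ≤ ∏ i ∈ s, (1 - (g i).v) :=
  Finset.prod_le_prod (fun i hi => (hK i hi).ζ_nonneg) fun i hi => (ζ_le (hK i hi)).2

/-- `0 ≤ Π ζᵢ`. -/
theorem prod_ζ_nonneg (hK : ∀ i ∈ s, MemK (g i)) : 0 ≤ ∏ i ∈ s, (g i).ζ :=
  Finset.prod_nonneg fun i hi => (hK i hi).ζ_nonneg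

/-- **`0 ≤ N`**: `N` is the probability `P(∃ a-bit ∧ ∃ b-bit)` of the product distribution —
adding a generator never decreases it. -/
theorem N_nonneg [DecidableEq ι] (hK : ∀ i ∈ s, MemK (g i)) : 0 ≤ N s g := by
  induction s using Finset.induction_on with
  | empty => simp [N]
  | insert i s hi ih =>
    have hK' : ∀ j ∈ s, MemK (g j) := fun j hj => hK j (Finset.mem_insert_of_mem hj)
    have h1 := ih hK'
    have h2 := prod_ζ_le_prod_u hK'
    have h3 := prod_ζ_le_prod_v hK'
    have h4 := prod_ζ_nonneg hK'
    have hi' := hK i (Finset.mem_insert_self i s)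
    have hu := u_mem hi'
    have hv := v_mem hi'
    have hν := hi'.ν_nonneg
    have hζ : (g i).ζ = 1 - (g i).u - (g i).v + (g i).ν := by
      unfold Gen.u Gen.v; linarith [hi'.norm]
    unfold N at h1 ⊢
    rw [Finset.prod_insert hi, Finset.prod_insert hi, Finset.prod_insert hi, hζ]
    nlinarith [mul_nonneg hu.1 (sub_nonneg.2 h2), mul_nonneg hv.1 (sub_nonneg.2 h3),
      mul_nonneg hν h4]

end Facts

/-! ### The `E1` base case: Lemma A -/

/-- **The `E1` base case**: if every generator of the family is an independent generator
`e(aᵢ, bᵢ)` with `aᵢ + bᵢ ≥ 1`, then `N = U·V` and `N² ≤ 𝒜ℬ` is Lemma A. -/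
theorem sq_le_of_forall_isE1 [DecidableEq ι] {s : Finset ι} {g : ι → Gen}
    (h : ∀ i ∈ s, IsE1 (g i)) : CS s g := by
  classical
  choose! a b hab using h
  have hu : ∀ i ∈ s, (g i).u = a i := fun i hi => by
    rw [(hab i hi).2.2.2.2.2]; simp only [Gen.u, Gen.e]; ring
  have hv : ∀ i ∈ s, (g i).v = b i := fun i hi => by
    rw [(hab i hi).2.2.2.2.2]; simp only [Gen.v, Gen.e]; ring
  have hζ : ∀ i ∈ s, (g i).ζ = (1 - a i) * (1 - b i) := fun i hi => by
    rw [(hab i hi).2.2.2.2.2]; rfl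
  have hα : ∀ i ∈ s, (g i).α = a i ^ 2 := fun i hi => by rw [(hab i hi).2.2.2.2.2]; rfl
  have hβ : ∀ i ∈ s, (g i).β = b i ^ 2 := fun i hi => by rw [(hab i hi).2.2.2.2.2]; rfl
  have p1 : ∏ i ∈ s, (1 - (g i).v) = ∏ i ∈ s, (1 - b i) :=
    Finset.prod_congr rfl fun i hi => by rw [hv i hi]
  have p2 : ∏ i ∈ s, (1 - (g i).u) = ∏ i ∈ s, (1 - a i) :=
    Finset.prod_congr rfl fun i hi => by rw [hu i hi]
  have p3 : ∏ i ∈ s, (g i).ζ = ∏ i ∈ s, ((1 - a i) * (1 - b i)) :=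
    Finset.prod_congr rfl fun i hi => hζ i hi
  have p4 : ∏ i ∈ s, (1 + (g i).α) = ∏ i ∈ s, (1 + a i ^ 2) :=
    Finset.prod_congr rfl fun i hi => by rw [hα i hi]
  have p5 : ∏ i ∈ s, (1 + (g i).β) = ∏ i ∈ s, (1 + b i ^ 2) :=
    Finset.prod_congr rfl fun i hi => by rw [hβ i hi]
  unfold CS N calA calB
  rw [p1, p2, p3, p4, p5, Finset.prod_mul_distrib]
  have key := lemmaA s (fun i hi => ⟨(hab i hi).1, (hab i hi).2.1⟩)
    (fun i hi => ⟨(hab i hi).2.2.1, (hab i hi).2.2.2.1⟩) fun i hi => (hab i hi).2.2.2.2.1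
  calc (1 - ∏ i ∈ s, (1 - b i) - ∏ i ∈ s, (1 - a i) + (∏ i ∈ s, (1 - a i)) * ∏ i ∈ s, (1 - b i)) ^ 2
      = ((1 - ∏ i ∈ s, (1 - a i)) * (1 - ∏ i ∈ s, (1 - b i))) ^ 2 := by ring
    _ ≤ _ := key

/-! ### Convexity of the cone `N² ≤ 𝒜ℬ` -/

/-- **The cone `{N² ≤ 𝒜ℬ, 𝒜, ℬ ≥ 0}` is convex**: a nonnegative combination of two members is a
member (Cauchy–Schwarz on two terms, in the squared form). -/
theorem sq_le_of_convex {N₁ A₁ B₁ N₂ A₂ B₂ c₁ c₂ : ℝ} (hA₁ : 0 ≤ A₁) (hB₁ : 0 ≤ B₁)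
    (hA₂ : 0 ≤ A₂) (hB₂ : 0 ≤ B₂) (h₁ : N₁ ^ 2 ≤ A₁ * B₁) (h₂ : N₂ ^ 2 ≤ A₂ * B₂) (hc₁ : 0 ≤ c₁)
    (hc₂ : 0 ≤ c₂) :
    (c₁ * N₁ + c₂ * N₂) ^ 2 ≤ (c₁ * A₁ + c₂ * A₂) * (c₁ * B₁ + c₂ * B₂) := by
  -- `2 N₁ N₂ ≤ A₁ B₂ + A₂ B₁`: `(N₁ N₂)² ≤ (A₁ B₁)(A₂ B₂) ≤ ((A₁ B₂ + A₂ B₁) / 2)²`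
  have hprod : (N₁ * N₂) ^ 2 ≤ (A₁ * B₂) * (A₂ * B₁) := by
    calc (N₁ * N₂) ^ 2 = N₁ ^ 2 * N₂ ^ 2 := by ring
      _ ≤ (A₁ * B₁) * (A₂ * B₂) :=
        mul_le_mul h₁ h₂ (sq_nonneg _) (mul_nonneg hA₁ hB₁)
      _ = (A₁ * B₂) * (A₂ * B₁) := by ring
  have hamgm : (A₁ * B₂) * (A₂ * B₁) ≤ ((A₁ * B₂ + A₂ * B₁) / 2) ^ 2 := by
    nlinarith [sq_nonneg (A₁ * B₂ - A₂ * B₁)]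
  have hkey : N₁ * N₂ ≤ (A₁ * B₂ + A₂ * B₁) / 2 := by
    have h0 : 0 ≤ (A₁ * B₂ + A₂ * B₁) / 2 := by positivity
    exact abs_le_of_sq_le_sq' (hprod.trans hamgm) h0 |>.2
  nlinarith [mul_nonneg hc₁ hc₂, mul_nonneg (mul_nonneg hc₁ hc₁) (sub_nonneg.2 h₁),
    mul_nonneg (mul_nonneg hc₂ hc₂) (sub_nonneg.2 h₂),
    mul_nonneg (mul_nonneg hc₁ hc₂) (sub_nonneg.2 hkey)]

/-! ### Factorisation at one index and monotonicity -/

section Rest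

variable [DecidableEq ι] {s : Finset ι} {g : ι → Gen} {i : ι}

/-- `N` of the family as an affine function of the generator at `i` with the others fixed. -/
theorem N_eq_rest (hi : i ∈ s) :
    N s g = 1 - (1 - (g i).v) * ∏ j ∈ s.erase i, (1 - (g j).v) -
      (1 - (g i).u) * ∏ j ∈ s.erase i, (1 - (g j).u) + (g i).ζ * ∏ j ∈ s.erase i, (g j).ζ := by
  unfold N
  rw [← Finset.mul_prod_erase s _ hi, ← Finset.mul_prod_erase s _ hi,
    ← Finset.mul_prod_erase s _ hi]

/-- `𝒜` of the family as an affine function of the generator at `i`. -/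
theorem calA_eq_rest (hi : i ∈ s) :
    calA s g = (1 + (g i).α) * ∏ j ∈ s.erase i, (1 + (g j).α) - 1 := by
  unfold calA
  rw [← Finset.mul_prod_erase s _ hi]

/-- `ℬ` of the family as an affine function of the generator at `i`. -/
theorem calB_eq_rest (hi : i ∈ s) :
    calB s g = (1 + (g i).β) * ∏ j ∈ s.erase i, (1 + (g j).β) - 1 := by
  unfold calB
  rw [← Finset.mul_prod_erase s _ hi]

/-- The family with the generator at `i` replaced: the `rest` products do not see the change. -/
theorem prod_erase_update (f : Gen → ℝ) (h : Gen) :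
    ∏ j ∈ s.erase i, f (Function.update g i h j) = ∏ j ∈ s.erase i, f (g j) :=
  Finset.prod_congr rfl fun j hj => by
    rw [Function.update_of_ne (Finset.ne_of_mem_erase hj)]

/-- **Monotonicity of `N` at one index**: with the other generators in `K`, replacing the generator
at `i` by one with `u, v, ν` at least as large does not decrease `N`. -/
theorem N_update_mono (hK : ∀ j ∈ s.erase i, MemK (g j)) (hi : i ∈ s) {h h' : Gen}
    (hu : h.u ≤ h'.u) (hv : h.v ≤ h'.v) (hν : h.ν ≤ h'.ν) (hζ : h.ζ = 1 - h.u - h.v + h.ν)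
    (hζ' : h'.ζ = 1 - h'.u - h'.v + h'.ν) :
    N s (Function.update g i h) ≤ N s (Function.update g i h') := by
  rw [N_eq_rest hi, N_eq_rest hi, Function.update_self, Function.update_self,
    prod_erase_update (fun x => 1 - x.v), prod_erase_update (fun x => 1 - x.u),
    prod_erase_update (fun x => x.ζ), prod_erase_update (fun x => 1 - x.v),
    prod_erase_update (fun x => 1 - x.u), prod_erase_update (fun x => x.ζ), hζ, hζ']
  have h2 := prod_ζ_le_prod_u hK
  have h3 := prod_ζ_le_prod_v hK
  have h4 := prod_ζ_nonneg hK
  nlinarith [mul_nonneg (sub_nonneg.2 hu) (sub_nonneg.2 h2),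
    mul_nonneg (sub_nonneg.2 hv) (sub_nonneg.2 h3), mul_nonneg (sub_nonneg.2 hν) h4]

/-- **Monotonicity of `𝒜` at one index**. -/
theorem calA_update_mono (hK : ∀ j ∈ s.erase i, MemK (g j)) (hi : i ∈ s) {h h' : Gen}
    (hα : h'.α ≤ h.α) :
    calA s (Function.update g i h') ≤ calA s (Function.update g i h) := by
  rw [calA_eq_rest hi, calA_eq_rest hi, Function.update_self, Function.update_self,
    prod_erase_update (fun x => 1 + x.α), prod_erase_update (fun x => 1 + x.α)]
  have : (0 : ℝ) ≤ ∏ j ∈ s.erase i, (1 + (g j).α) :=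
    Finset.prod_nonneg fun j hj => by linarith [(hK j hj).α_nonneg]
  nlinarith

/-- **Monotonicity of `ℬ` at one index**. -/
theorem calB_update_mono (hK : ∀ j ∈ s.erase i, MemK (g j)) (hi : i ∈ s) {h h' : Gen}
    (hβ : h'.β ≤ h.β) :
    calB s (Function.update g i h') ≤ calB s (Function.update g i h) := by
  rw [calB_eq_rest hi, calB_eq_rest hi, Function.update_self, Function.update_self,
    prod_erase_update (fun x => 1 + x.β), prod_erase_update (fun x => 1 + x.β)]
  have : (0 : ℝ) ≤ ∏ j ∈ s.erase i, (1 + (g j).β) :=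
    Finset.prod_nonneg fun j hj => by linarith [(hK j hj).β_nonneg]
  nlinarith

end Rest

end ProdCS

end PercRepro
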